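import Literature.NumberTheory.LFunctions.NicolasCChainRun
import Literature.NumberTheory.LFunctions.NicolasCChainSound
import Literature.NumberTheory.LFunctions.NicolasCLimsupRH
import Literature.NumberTheory.LFunctions.SchoenfeldThetaLarge
import HarnessLib

/-!
# RH-EQUIVALENT — Nicolas 2012, Cor. 1.1 (1.7): `RH ↔ c(N_k) ≥ c(2)` for every `k ≥ 1`, and Thm. 1.1 (1.7) PROVED under RH; nothing here bears on the truth of RH

RH-EQUIVALENT (a proved equivalence) / RH-CONDITIONAL (Thm. 1.1 (1.7) has the hypothesis
`RiemannHypothesis`); nothing here bears on the truth of RH. Literature-typing tranche 1 (Broughan,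
*Equivalents of the Riemann Hypothesis* vol. 1, §5.7), from the primary source J.-L. Nicolas, *Small
values of the Euler function and the Riemann hypothesis*, Acta Arith. 155 (2012), 311–321, Thm. 1.1:

  (1.7) under RH, `∀ k ≥ 1, c(N_k) ≥ c(N_1) = c(2) = 2.2085892614…`,
  `c(n) = (n/φ(n) − e^γ log log n) √(log n)`, `N_k = 2·3·…·p_k`;

  Cor. 1.1: (1.7) is equivalent to the Riemann hypothesis.

The named fact `Nicolas2012_thm1_1` (`NicolasCriterion.lean`) carries (1.7) as its last conjunct,
`∀ p prime, nicolasC 2 ≤ nicolasC (primorial p)`. It is PROVED here in three ranges: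

* `p ≥ 599² = 358801` — analytic, §3 of the paper under RH with Schoenfeld's bound
  `|θ(x) − x| ≤ √x log²x/(8π)` (`x ≥ 599`): `c(p#) ≥ 2.65 > 2.41 ≥ c(2)`
  (`NicolasLimsup.nicolasC_two_lt_nicolasC_primorial_of_RH`, `NicolasCLimsupRH.lean` §9; the paper
  settles `k > π(10⁹)` this way, (3.3));
* `3 ≤ p ≤ 360649` — the paper's table of `c(N_k)` ("we have calculated `c(N_k)` in Maple", §4),
  replaced by a kernel certificate: the `c`-chain `NicolasCChainCheck.lean` run to the prime
  `360649 > 599²` (`NicolasCChainRun.run`, `decide +kernel`) proves `c(p#) ≥ 2.2088`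
  (`NicolasCChain.runDC_sound`, `NicolasCChain.initC_inv`), and `c(2) ≤ 2.2088`
  (`NicolasCChain.nicolasC_two_le_ctwo`);
* `p = 2` — equality.

Results: `nicolasC_two_le_nicolasC_primorial_of_le` (the certified finite range, RH-free),
`riemannHypothesis_iff_nicolasC_two_le_of_theta` (Cor. 1.1 (1.7) over the named fact
`Schoenfeld1976_theta`, standard axioms), `riemannHypothesis_iff_nicolasC_two_le` and
`Nicolas2012_thm1_1_eq7` (fed with the tree's PROVED `Schoenfeld1976_theta_holds`, whose certified
zeta-zero numerics make these two computational in the gate's axiom census). The converse direction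
(`c(N_k) ≥ c(2)` for all `k` ⟹ RH) is the tree's `riemannHypothesis_iff_nicolasC_two_le_of_smallRange`
(from Nicolas 1983: if RH fails, `c(N_k) < 0` for infinitely many `k`).

## References

* J.-L. Nicolas, *Small values of the Euler function and the Riemann hypothesis*, Acta Arith. 155
  (2012), 311–321, Thm. 1.1 (1.7), Cor. 1.1, §§3–4. [Nicolas2012]
* L. Schoenfeld, *Sharper bounds for the Chebyshev functions θ(x) and ψ(x). II*, Math. Comp. 30
  (1976), 337–360, (6.3). [Schoenfeld1976]
* K. Broughan, *Equivalents of the Riemann Hypothesis*, vol. 1, CUP 2017, §5.7. [Broughan2017]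
-/

noncomputable section

namespace Literature.NumberTheory.LFunctions

open NicolasCChain

/-- **The certified finite range** (RH-free): `c(2) ≤ c(p#)` for every prime `p ≤ 360649`
(`c(p#) ≥ 2.2088 ≥ c(2)` for `3 ≤ p ≤ 360649` by the kernel-checked `c`-chain; equality at `p = 2`).
[cite: Nicolas2012, Thm. 1.1 (1.7) and §4 (table of `c(N_k)`)] -/
theorem nicolasC_two_le_nicolasC_primorial_of_le {p : ℕ} (hp : p.Prime) (hle : p ≤ 360649) :
    nicolasC 2 ≤ nicolasC (primorial p) := by
  have hrun := NicolasCChainRun.run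
  rcases h : runDC 30800 initC with _ | s'
  · rw [h] at hrun; simp at hrun
  · rw [h] at hrun
    simp only [Option.map_some, Option.some.injEq] at hrun
    have hI : Inv s' := runDC_sound initC_inv h
    exact nicolasC_two_le_of_inv hI hp (hrun ▸ hle)

/-- **`c(p#) ≥ 2.2088` for every prime `3 ≤ p ≤ 360649`** (the certified table, RH-free).
[cite: Nicolas2012, §4 (table of `c(N_k)`)] -/
theorem nicolasC_primorial_ge_ctwo_of_le {p : ℕ} (hp : p.Prime) (h3 : 3 ≤ p) (hle : p ≤ 360649) :
    (2.2088 : ℝ) ≤ nicolasC (primorial p) := by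
  have hrun := NicolasCChainRun.run
  rcases h : runDC 30800 initC with _ | s'
  · rw [h] at hrun; simp at hrun
  · rw [h] at hrun
    simp only [Option.map_some, Option.some.injEq] at hrun
    have hI : Inv s' := runDC_sound initC_inv h
    exact hI.ctwo p hp h3 (hrun ▸ hle)

/-- **Nicolas 2012, Cor. 1.1 (1.7)** over Schoenfeld's RH-bound for `θ` as a named fact:
`RH ↔ ∀ k ≥ 1, c(N_k) ≥ c(2)`. Standard axioms. [cite: Nicolas2012, Cor. 1.1 with (1.7)] -/
theorem riemannHypothesis_iff_nicolasC_two_le_of_theta (hS : Schoenfeld1976_theta) :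
    RiemannHypothesis ↔ ∀ p : ℕ, p.Prime → nicolasC 2 ≤ nicolasC (primorial p) :=
  riemannHypothesis_iff_nicolasC_two_le_of_smallRange hS fun _ hp hlt ↦
    nicolasC_two_le_nicolasC_primorial_of_le hp (by omega)

/-- **Nicolas 2012, Thm. 1.1 (1.7)** over Schoenfeld's RH-bound for `θ` as a named fact: under RH,
`c(N_k) ≥ c(N_1) = c(2)` for every `k ≥ 1`. Standard axioms. [cite: Nicolas2012, Thm. 1.1 (1.7)] -/
theorem Nicolas2012_thm1_1_eq7_of (hS : Schoenfeld1976_theta) (hRH : RiemannHypothesis) :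
    ∀ p : ℕ, p.Prime → nicolasC 2 ≤ nicolasC (primorial p) :=
  (riemannHypothesis_iff_nicolasC_two_le_of_theta hS).1 hRH

/-- **Nicolas 2012, Cor. 1.1 (1.7)**: `RH ↔ ∀ k ≥ 1, c(N_k) ≥ c(2)` — unconditionally, with the
tree's proved `Schoenfeld1976_theta_holds` (computational: certified zeta-zero numerics).
[cite: Nicolas2012, Cor. 1.1 with (1.7)] -/
theorem riemannHypothesis_iff_nicolasC_two_le :
    RiemannHypothesis ↔ ∀ p : ℕ, p.Prime → nicolasC 2 ≤ nicolasC (primorial p) :=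
  riemannHypothesis_iff_nicolasC_two_le_of_theta Schoenfeld1976_theta_holds

/-- **Nicolas 2012, Thm. 1.1 (1.7)**: under RH, `c(N_k) ≥ c(N_1) = c(2)` for every `k ≥ 1` — the last
conjunct of the named fact `Nicolas2012_thm1_1`, proved (computational via
`Schoenfeld1976_theta_holds`). [cite: Nicolas2012, Thm. 1.1 (1.7)] -/
theorem Nicolas2012_thm1_1_eq7 (hRH : RiemannHypothesis) :
    ∀ p : ℕ, p.Prime → nicolasC 2 ≤ nicolasC (primorial p) :=
  riemannHypothesis_iff_nicolasC_two_le.1 hRH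

/-- **The named fact `Nicolas2012_thm1_1` from its two remaining computational clauses**: with (1.4)
(`Nicolas2012_thm1_1_limsup`) and (1.7) (`Nicolas2012_thm1_1_eq7`) proved, Thm. 1.1 follows from
(1.5) and (1.6) alone (Nicolas's table of `c(N_k)`, `k ≤ π(10⁹)`, and Lemma 3.1).
[cite: Nicolas2012, Thm. 1.1 (1.5)–(1.6), §4] -/
theorem Nicolas2012_thm1_1_of_eq5_eq6
    (h15 : RiemannHypothesis → ∀ n : ℕ, primorial 1591883 ≤ n → nicolasC n < nicolasCLimsup)
    (h16 : RiemannHypothesis → ∀ n : ℕ, 2 ≤ n → nicolasC n ≤ nicolasC (primorial 317)) :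
    Nicolas2012_thm1_1 :=
  Nicolas2012_thm1_1_of_clauses h15 h16 Nicolas2012_thm1_1_eq7

end Literature.NumberTheory.LFunctions

end
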